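import Mathlib
import Summits.HodgeConjecture.FermatCycles.HodgeFermatLemmaNB

/-!
# The χ₃-moment of a CM type: LEMMA E at the character χ₃ × 1 — part 1: χ₃, units, `S(m)`, `c_m(x)` (`HodgeFermat/ChiThree.lean`)

Tree copy (part 1 of 2) of the module `HodgeFermat/ChiThree.lean` of the sibling cell's standalone package
`run/shared/lean/pub/pub-hodgefermat/lean/HodgeFermat/` (474 lines, sha256 `1b65ac1fe913f0ab…`), source lines 48–264 (χ₃, ν, units, the twisted moment `S(m)` and the transform `c_m(x)`).
Filed by cell `pub-hfermat`, seat prover-1 gen-0, on the COORDINATOR KEEPER RULING of 2026-08-25 (gem sweep H1: take the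
off-gate kernel theorem `thmFstar` — `HodgeFermat/DecodingFinal.lean:29` — through the gate); this file is one link of the
minimal import closure of `thmFstar`.  The source module's declarations are VERBATIM those of the cell record
`check/DecodingFinal_standalone.lean` (27 bodies, 454 223 B, sha256 dca6f17de93119a6…, hub `lean check` rc 0, 130.1 s; pub-hodgefermat `CERT.md` l.978, GATE HF-G32).
Deviations from the source module, exhaustively: the `import` lines (tree modules `Summits.HodgeConjecture.FermatCycles.
HodgeFermat*` instead of `HodgeFermat.*`); this module docstring; one-line docstrings added (gate lint) to `chi3_mul`, `chi3_mod`, `chi3_mul_self`, `chi3_of_dvd`, `coprime_mod_iff`, `not_three_dvd_of_coprime`, `card_units`; the file ends at source l.264 with an `end` line (part 2 = `HodgeFermatChiThreeB.lean`).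
Every other line — in particular every declaration's statement and proof — is byte-identical to the source.
HONEST FRAMING: explicit algebraic cycles for specific Hodge classes on Fermat/Delsarte varieties; residual open instances
listed; no claim on general Hodge.  (This file is arithmetic of CM types; it claims nothing about cycles.)

The source module's docstring (ChiThree.lean l.3–46), verbatim:

## The χ₃-moment of a CM type: LEMMA E at the character χ₃ × 1 (build hodge-fermat, generation 31, HF-G31)

`tables/DPRIME-THEOREM.md` §6 (LEMMA E, the case `m₀ = 3` written out) attaches to a triple `T = (a, b, c)` of level
`m = 3n` the integer measure `ν_T = Σ_{x ∈ T, 3 ∤ x} χ₃(x) δ_x` on `(ℤ/n)ˣ` and asserts, for a coincidence of CM types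
`T ∼ T′` with all entries units mod `n`, that `ν̂_T(ψ) = ν̂_{T′}(ψ)` for every even character `ψ` mod `n` outside the
set `Bad`.  This file puts the FIRST instance of LEMMA E into the kernel — the trivial character `ψ = 1`, i.e. the
odd character `χ = χ₃ × 1` of `(ℤ/3n)ˣ`, which is good exactly when no prime `q ≡ 1 (mod 3)` divides `n`
[`three_dvd_totient_iff`: for `3 ∤ n` this is `3 ∤ φ(n)`]:

THEOREM (Σν) [`nu_eq_of_sameType`, `nu_eq_of_sameType_units`, `nu_eq_of_sameType_primes`].  Let `m = 3n` with
`3 ∤ n` and `3 ∤ φ(n)`.  Let `T = (a, b, c)`, `T′ = (a′, b′, c′)` have zero sums mod `m` and the same CM type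
(`SameType`, the model of `LemmaN.lean` / `PropL5.lean` verbatim), every entry being either divisible by `3` or a unit
mod `m`, and the third entries `c, c′ ≢ 0 (mod m)` (in particular: all six entries units mod `n`, `n > 1`).  Then
`ν(T) = ν(T′)`, where `ν(x, y, z) = χ₃(x) + χ₃(y) + χ₃(z)` and `χ₃(x) = 1, −1, 0` for `x ≡ 1, 2, 0 (mod 3)` [`chi3`, `nu`].

COROLLARY (no pattern (U, Z1) or (U, Z3) at the prime 3) [`U_iff_of_sameType`, `no_UZ_three`].  Under the same
hypotheses, `T` has all three entries prime to `3` iff `T′` does; and if both do, `a ≡ a′ (mod 3)` [`UU_class`]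
(a zero-sum triple prime to `3` has `a ≡ b ≡ c (mod 3)` and `ν = ±3`; a zero-sum triple with an entry divisible by `3`
has `ν = 0`).  So at these levels a coincidence never pairs a triple of pattern U at 3 with a triple of pattern Z1 or
Z3 at 3 — for shared and disjoint pairs alike, `n` even or odd, squarefree or not.  The levels `m = 21 = 3·7` and
`39 = 3·13` of the exceptional coincidences (`7 ≡ 13 ≡ 1 (mod 3)`) are exactly of the excluded kind, and there the
conclusion fails: `(1, 1, 19) ∼ (1, 3, 17)` at `21` has `ν = 3 ≠ 0` (planted control MA of this generation).

Proof (kernel, elementary and character-free apart from the sign `χ₃`; no L-functions).  For a unit `t` of `ℤ/m`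
the residue sums agree: `⟨ta⟩ + ⟨tb⟩ + ⟨tc⟩ = ⟨ta′⟩ + ⟨tb′⟩ + ⟨tc′⟩` (`rsum_cases` of `LemmaN.lean`: each side is `m`
or `2m`, and it is `m` iff `t ∈ H`).  Multiply by `χ₃(t)` and sum over the units `t < m` [`units`]: the left side
becomes `c(a) + c(b) + c(c)` with `c(x) := Σ_t χ₃(t)⟨tx⟩_m` [`cm`, `sum_chi3_rsum`].  Two evaluations:
 • `x` a unit mod `m` [`cm_of_coprime`]: substituting `u = tx` (a permutation of the units [`sum_units_mul_reindex`])
   and using `χ₃(t) = χ₃(x)χ₃(tx)` gives `c(x) = χ₃(x)·S(m)`, `S(m) := Σ_{u unit} χ₃(u)·u` [`S`];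
 • `3 ∣ x` [`cm_of_three_dvd`]: the unit `j = 1 + n·(n mod 3)` of `ℤ/m` has `j ≡ 2 (mod 3)`, `j ≡ 1 (mod n)`, hence
   `jx ≡ x (mod m)`; the substitution `t ↦ jt` fixes `⟨tx⟩` and flips the sign of `χ₃(t)`, so `c(x) = −c(x) = 0 = χ₃(x)·S(m)`.
Hence `S(m)·ν(T) = S(m)·ν(T′)` [`cm_eq`].  Finally `S(m) ≠ 0` [`S_ne_zero`]: `χ₃(u)·u ≡ u² ≡ 1 (mod 3)` for every unit
`u`, so `S(m) ≡ φ(m) = 2φ(n) ≢ 0 (mod 3)` [`three_dvd_S_sub_card`].  (In fact `S(3n) = −n·Π_{q ∣ n}(1 − χ₃(q))` — the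
Koblitz–Rohrlich / `B_{1,χ}` evaluation behind LEMMA E — which vanishes iff some prime `q ≡ 1 (mod 3)` divides `n`;
only the congruence is needed and proved here.  Numerical cross-read of the identity for `n ≤ 2000` and of the theorem on
all same-type pairs at `m = 3n ≤ 231`: `code/gen31/chi3_scan.py`, `results/gen31/local/chi3_scan_231.txt`.)

Kernel instance (non-vacuity) at `m = 33`: `(1, 9, 23) ∼ (3, 9, 21)` (a shared Z1/Z3 pair, all entries units mod 11,
`ν = 0 = 0`), the coincidence certified by `decide` on the 20 units [`sameType_of_fin`].

LIGHT module: imports `LemmaN` only (`InH`, `SameType`, `rsum`, `rsum_cases`); `set_option autoImplicit false`; no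
`sorry`, no `native_decide`; axioms of every theorem = [propext, Classical.choice, Quot.sound].
-/

set_option autoImplicit false

namespace HodgeFermat.KRFree.ChiThree

open Finset HodgeFermat.KRFree.LemmaN

/-! ## χ₃, ν, the units and the twisted moments -/

/-- the quadratic character mod `3` as an integer-valued function on `ℕ`: `χ₃(x) = 1, −1, 0` for `x ≡ 1, 2, 0 (mod 3)` -/
def chi3 (x : ℕ) : ℤ := if x % 3 = 1 then 1 else if x % 3 = 2 then -1 else 0

/-- `ν(T) = χ₃(a) + χ₃(b) + χ₃(c)` — the total mass of the measure `ν_T` of LEMMA E (entries divisible by `3` contribute `0`) -/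
def nu (T : ℕ × ℕ × ℕ) : ℤ := chi3 T.1 + chi3 T.2.1 + chi3 T.2.2

/-- the units of `ℤ/m`, as residues `t < m` with `gcd(t, m) = 1` -/
def units (m : ℕ) : Finset ℕ := (range m).filter (fun t => Nat.Coprime t m)

/-- `S(m) = Σ_{u unit} χ₃(u)·u`, the `χ₃`-twisted first moment of the units -/
def S (m : ℕ) : ℤ := ∑ u ∈ units m, chi3 u * (u : ℤ)

/-- `c_m(x) = Σ_{t unit} χ₃(t)·⟨tx⟩_m`, the `χ₃`-twisted residue transform of the single residue `x` -/
def cm (m x : ℕ) : ℤ := ∑ t ∈ units m, chi3 t * ((t * x % m : ℕ) : ℤ)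

/-! ## Elementary facts about χ₃ -/

/-- `χ₃` is multiplicative -/
lemma chi3_mul (x y : ℕ) : chi3 (x * y) = chi3 x * chi3 y := by
  have h : x * y % 3 = (x % 3) * (y % 3) % 3 := Nat.mul_mod _ _ _
  have hx : x % 3 = 0 ∨ x % 3 = 1 ∨ x % 3 = 2 := by omega
  have hy : y % 3 = 0 ∨ y % 3 = 1 ∨ y % 3 = 2 := by omega
  unfold chi3
  rcases hx with hx | hx | hx <;> rcases hy with hy | hy | hy <;> simp [h, hx, hy]

/-- `χ₃` depends only on the residue mod any multiple of `3` -/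
lemma chi3_mod {m : ℕ} (x : ℕ) (hm : 3 ∣ m) : chi3 (x % m) = chi3 x := by
  unfold chi3
  rw [Nat.mod_mod_of_dvd x hm]

/-- `χ₃(x)² = 1` for `3 ∤ x` -/
lemma chi3_mul_self {x : ℕ} (hx : ¬ 3 ∣ x) : chi3 x * chi3 x = 1 := by
  have h : x % 3 = 1 ∨ x % 3 = 2 := by omega
  unfold chi3
  rcases h with h | h <;> simp [h]

/-- `χ₃(x) = 0` for `3 ∣ x` -/
lemma chi3_of_dvd {x : ℕ} (hx : 3 ∣ x) : chi3 x = 0 := by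
  have h : x % 3 = 0 := by omega
  unfold chi3
  simp [h]

/-- `χ₃(u)·u ≡ u² ≡ 1 (mod 3)` for `3 ∤ u` -/
lemma three_dvd_chi3_mul_sub_one {u : ℕ} (hu : ¬ 3 ∣ u) : (3 : ℤ) ∣ chi3 u * (u : ℤ) - 1 := by
  have h : u % 3 = 1 ∨ u % 3 = 2 := by omega
  unfold chi3
  rcases h with h | h
  · rw [if_pos h]
    omega
  · rw [if_neg (by omega), if_pos h]
    omega

/-! ## Units: reduction mod `m`, reindexing, cardinality -/

/-- `a mod N` is prime to `N` iff `a` is -/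
lemma coprime_mod_iff (a N : ℕ) : Nat.Coprime (a % N) N ↔ Nat.Coprime a N := by
  unfold Nat.Coprime
  rw [← Nat.gcd_rec, Nat.gcd_comm]

/-- a unit mod a multiple of `3` is prime to `3` -/
lemma not_three_dvd_of_coprime {u m : ℕ} (hm : 3 ∣ m) (hu : Nat.Coprime u m) : ¬ 3 ∣ u := by
  intro h
  have h1 := Nat.dvd_gcd h hm
  rw [hu.gcd_eq_one] at h1
  omega

/-- multiplication by a unit `x` permutes the units of `ℤ/m` (as residues `< m`): reindexing a sum -/
lemma sum_units_mul_reindex {m x : ℕ} (hm : 1 < m) (hx : Nat.Coprime x m) (f : ℕ → ℤ) :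
    ∑ t ∈ units m, f (t * x % m) = ∑ t ∈ units m, f t := by
  obtain ⟨y, -, hy⟩ := Nat.exists_mul_mod_eq_one_of_coprime hx hm
  have hy' : Nat.Coprime y m := by
    have h1 : Nat.Coprime (x * y % m) m := by rw [hy]; exact Nat.coprime_one_left m
    exact Nat.Coprime.coprime_mul_left ((coprime_mod_iff _ _).mp h1)
  apply Finset.sum_nbij' (fun t => t * x % m) (fun t => t * y % m)
  · intro t ht
    simp only [units, mem_filter, mem_range] at ht ⊢
    exact ⟨Nat.mod_lt _ (by omega), (coprime_mod_iff _ _).mpr (Nat.Coprime.mul_left ht.2 hx)⟩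
  · intro t ht
    simp only [units, mem_filter, mem_range] at ht ⊢
    exact ⟨Nat.mod_lt _ (by omega), (coprime_mod_iff _ _).mpr (Nat.Coprime.mul_left ht.2 hy')⟩
  · intro t ht
    simp only [units, mem_filter, mem_range] at ht
    show t * x % m * y % m = t
    rw [Nat.mod_mul_mod, mul_assoc, Nat.mul_mod, hy, mul_one, Nat.mod_mod, Nat.mod_eq_of_lt ht.1]
  · intro t ht
    simp only [units, mem_filter, mem_range] at ht
    show t * y % m * x % m = t
    have hy2 : y * x % m = 1 := by rw [mul_comm]; exact hy
    rw [Nat.mod_mul_mod, mul_assoc, Nat.mul_mod, hy2, mul_one, Nat.mod_mod, Nat.mod_eq_of_lt ht.1]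
  · intro t _
    rfl

/-- `#units(m) = φ(m)` -/
lemma card_units (m : ℕ) : (units m).card = Nat.totient m := by
  rw [Nat.totient_eq_card_coprime]
  exact congrArg Finset.card (Finset.filter_congr (fun t _ => Nat.coprime_comm))

/-! ## The twisted moment `S(m)` is `≡ φ(m) (mod 3)`, hence non-zero when `3 ∤ φ(m)` -/

/-- `S(m) ≡ #units = φ(m) (mod 3)` when `3 ∣ m` -/
lemma three_dvd_S_sub_card {m : ℕ} (hm : 3 ∣ m) : (3 : ℤ) ∣ S m - ((units m).card : ℤ) := by
  rw [Finset.card_eq_sum_ones, Nat.cast_sum, S, ← Finset.sum_sub_distrib]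
  apply Finset.dvd_sum
  intro u hu
  have hu' : Nat.Coprime u m := by
    simp only [units, mem_filter] at hu
    exact hu.2
  push_cast
  exact three_dvd_chi3_mul_sub_one (not_three_dvd_of_coprime hm hu')

/-- for `3 ∤ n`: `3 ∣ φ(n)` iff some prime `q ≡ 1 (mod 3)` divides `n` (so "`3 ∤ φ(n)`" below says: every prime factor
of `n` is `2` or `≡ 2 (mod 3)`, i.e. the character `χ₃ × 1` of level `3n` is good in the sense of LEMMA E) -/
theorem three_dvd_totient_iff {n : ℕ} (hn : n ≠ 0) (h3 : ¬ 3 ∣ n) :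
    3 ∣ Nat.totient n ↔ ∃ q, Nat.Prime q ∧ q ∣ n ∧ q % 3 = 1 := by
  rw [Nat.totient_eq_prod_factorization hn, Finsupp.prod, Nat.support_factorization,
    Prime.dvd_finsetProd_iff Nat.prime_three.prime]
  constructor
  · rintro ⟨q, hq, hdvd⟩
    obtain ⟨hqp, hqn, -⟩ := Nat.mem_primeFactors.mp hq
    refine ⟨q, hqp, hqn, ?_⟩
    rcases (Nat.Prime.dvd_mul Nat.prime_three).mp hdvd with h | h
    · have h3q : 3 ∣ q := Nat.Prime.dvd_of_dvd_pow Nat.prime_three h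
      have h3q' : 3 = q := (Nat.prime_dvd_prime_iff_eq Nat.prime_three hqp).mp h3q
      exact absurd (h3q' ▸ hqn) h3
    · have h2 := hqp.two_le
      have h3q : ¬ 3 ∣ q := fun h' => h3 (dvd_trans h' hqn)
      omega
  · rintro ⟨q, hqp, hqn, hq1⟩
    refine ⟨q, Nat.mem_primeFactors.mpr ⟨hqp, hqn, hn⟩, ?_⟩
    apply Dvd.dvd.mul_left
    have h2 := hqp.two_le
    omega

/-- `S(3n) ≠ 0` when `3 ∤ n` and `3 ∤ φ(n)`:  `S(3n) ≡ φ(3n) = 2φ(n) ≢ 0 (mod 3)` -/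
theorem S_ne_zero {n : ℕ} (h3n : ¬ 3 ∣ n) (hφ : ¬ 3 ∣ Nat.totient n) : S (3 * n) ≠ 0 := by
  intro hS
  have htot : Nat.totient (3 * n) = 2 * Nat.totient n := by
    rw [Nat.totient_mul ((Nat.Prime.coprime_iff_not_dvd Nat.prime_three).mpr h3n),
      Nat.totient_prime Nat.prime_three]
  have h := three_dvd_S_sub_card (dvd_mul_right 3 n)
  rw [card_units, hS, htot] at h
  apply hφ
  have h' : (3 : ℤ) ∣ (Nat.totient n : ℤ) := by
    push_cast at h
    omega
  exact_mod_cast h'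

/-! ## Evaluation of the twisted residue transform `c_m(x)` -/

/-- a unit entry: `c_m(x) = χ₃(x)·S(m)` (substitute `u = tx`; `χ₃(t) = χ₃(x)·χ₃(tx)`) -/
theorem cm_of_coprime {m x : ℕ} (hm : 1 < m) (h3 : 3 ∣ m) (hx : Nat.Coprime x m) :
    cm m x = chi3 x * S m := by
  have h3x : ¬ 3 ∣ x := not_three_dvd_of_coprime h3 hx
  have hsq := chi3_mul_self h3x
  unfold cm S
  rw [Finset.mul_sum]
  have key : ∀ t ∈ units m,
      chi3 t * ((t * x % m : ℕ) : ℤ) = chi3 x * (chi3 (t * x % m) * ((t * x % m : ℕ) : ℤ)) := by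
    intro t _
    rw [chi3_mod _ h3, chi3_mul]
    linear_combination (-(chi3 t * ((t * x % m : ℕ) : ℤ))) * hsq
  rw [Finset.sum_congr rfl key]
  exact sum_units_mul_reindex hm hx (fun u => chi3 x * (chi3 u * (u : ℤ)))

/-- an entry divisible by `3` at a level `3n`, `3 ∤ n`: `c_{3n}(x) = 0` (the unit `j = 1 + n(n mod 3)` fixes `⟨tx⟩` and
flips `χ₃(t)`) -/
theorem cm_of_three_dvd {n x : ℕ} (hn : 0 < n) (h3n : ¬ 3 ∣ n) (hx : 3 ∣ x) : cm (3 * n) x = 0 := by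
  obtain ⟨x', rfl⟩ := hx
  obtain ⟨j, hj_def⟩ : ∃ j, j = 1 + n * (n % 3) := ⟨_, rfl⟩
  have h1m : 1 < 3 * n := by omega
  have hj3 : j % 3 = 2 := by
    have h : n % 3 = 1 ∨ n % 3 = 2 := by omega
    have e : j = 1 + n * (n % 3) := hj_def
    rcases h with h | h <;> rw [h] at e <;> omega
  have hjx : j * (3 * x') % (3 * n) = 3 * x' % (3 * n) := by
    have e : j * (3 * x') = 3 * x' + (n % 3 * x') * (3 * n) := by rw [hj_def]; ring
    rw [e, Nat.add_mul_mod_self_right]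
  have hjm : Nat.Coprime j (3 * n) := by
    apply Nat.Coprime.mul_right
    · exact Nat.coprime_comm.mp ((Nat.Prime.coprime_iff_not_dvd Nat.prime_three).mpr (by omega))
    · have hjn : j % n = 1 % n := by rw [hj_def, Nat.add_mul_mod_self_left]
      have h1 : Nat.Coprime (j % n) n := by
        rw [hjn]; exact (coprime_mod_iff 1 n).mpr (Nat.coprime_one_left n)
      exact (coprime_mod_iff j n).mp h1
  have hj' : chi3 j = -1 := by
    unfold chi3
    rw [if_neg (by omega), if_pos hj3]
  -- the substitution t ↦ jt: the transform equals its own negative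
  have key : ∑ t ∈ units (3 * n), chi3 (t * j % (3 * n)) * (((t * j % (3 * n)) * (3 * x') % (3 * n) : ℕ) : ℤ)
      = cm (3 * n) (3 * x') :=
    sum_units_mul_reindex h1m hjm (fun t => chi3 t * ((t * (3 * x') % (3 * n) : ℕ) : ℤ))
  have neg : ∀ t ∈ units (3 * n),
      chi3 (t * j % (3 * n)) * (((t * j % (3 * n)) * (3 * x') % (3 * n) : ℕ) : ℤ)
        = -(chi3 t * ((t * (3 * x') % (3 * n) : ℕ) : ℤ)) := by
    intro t _
    rw [chi3_mod _ (dvd_mul_right 3 n), chi3_mul, Nat.mod_mul_mod, mul_assoc t j (3 * x'),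
      Nat.mul_mod t (j * (3 * x')) (3 * n), hjx, ← Nat.mul_mod, hj']
    ring
  rw [Finset.sum_congr rfl neg, Finset.sum_neg_distrib] at key
  have hcm : cm (3 * n) (3 * x') = ∑ t ∈ units (3 * n), chi3 t * ((t * (3 * x') % (3 * n) : ℕ) : ℤ) := rfl
  linarith

/-- uniform form: `c_{3n}(x) = χ₃(x)·S(3n)` for every admissible entry (divisible by `3`, or a unit mod `3n`) -/
theorem cm_eq {n x : ℕ} (hn : 0 < n) (h3n : ¬ 3 ∣ n) (hx : 3 ∣ x ∨ Nat.Coprime x (3 * n)) :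
    cm (3 * n) x = chi3 x * S (3 * n) := by
  rcases hx with hx | hx
  · rw [cm_of_three_dvd hn h3n hx, chi3_of_dvd hx, zero_mul]
  · exact cm_of_coprime (by omega) (dvd_mul_right 3 n) hx

/-- `Σ_t χ₃(t)·(⟨ta⟩ + ⟨tb⟩ + ⟨tc⟩) = c(a) + c(b) + c(c)` -/
lemma sum_chi3_rsum (m a b c : ℕ) :
    ∑ t ∈ units m, chi3 t * (rsum m (a, b, c) t : ℤ) = cm m a + cm m b + cm m c := by
  simp only [cm, rsum, ← Finset.sum_add_distrib]
  refine Finset.sum_congr rfl (fun t _ => ?_)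
  push_cast
  ring

end HodgeFermat.KRFree.ChiThree
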